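import Summits.HodgeConjecture.HodgeConjecture.Theorems.AffinePartDecayWeakLefschetzAlgebraicClassesSidewaysFibres
import Summits.HodgeConjecture.HodgeConjecture.Theorems.AffinePartDecayWeakLefschetzAlgebraicClassesHodgeTypeReflected
import Literature.AlgebraicGeometry.HodgeTheory.PencilStepBelowMiddleFixedClass
import Literature.AlgebraicGeometry.Motives.UniversalHyperplaneSectionFibreSection
import HarnessLib

/-!
# Route AffinePartDecay — crux `WeakLefschetzAlgebraicClasses` (stmt-HodgeConjecture-1968), line `sideways_vhc_sweep`: the sweep comes back down by a PENCIL; the first open case `p = 2` modulo (V) and (A) only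

The line `Cruxes/WeakLefschetzAlgebraicClasses/Lines/sideways_vhc_sweep.lean` composes the crux from five
registered stubs: (R) [landed, `Theorems.stub_hodgeTypeReflected`], (V) the variational Hodge conjecture
[open crux stmt-HodgeConjecture-1076], (A) the anchor on one smooth hyperplane section [open], (T) sideways
transfer by VHC [landed, `Theorems.sidewaysTransfer_proj`], and (S) `stub_universalSpread` (spreading over
the complete linear system `(ℙᴺ)^*`; a documented tree gap) followed by the incidence-divisor descent.
Here the way back DOWN from "algebraic on every smooth hyperplane section" to "algebraic on `X`" uses
no spreading over `(ℙᴺ)^*`: given the Hodge conjecture one codimension down on `X`, a Lefschetz PENCIL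
suffices (`HodgeTheory.mem_algebraicClasses_of_pencil_members`, `Literature/…/PencilStepBelowMiddleFixedClass`:
discharged spreading of fibrewise SUPPORTS over `ℙ¹` and the pencil descent; de Cataldo–Migliorini 2009
§4, Thomas 2005 §2). In codimension `2` the lower Hodge conjecture is Lefschetz `(1,1)`, a theorem, so:

* `mem_algebraicClasses_of_forall_fiberOver_proj` — `X ⊆ ℙᴺ` smooth projective of dimension `n + 1`,
  `2(q+1) ≤ n`, rational `(q,q)`-classes of `X` algebraic; a class `c ∈ H^{2q+2}(X(ℂ); ℂ)` algebraic on
  every smooth `n`-dimensional fibre `X ∩ H` of `proj : 𝒴 ⟶ (ℙᴺ)^*` is algebraic. Mechanism: a good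
  pencil of `X` through the generic-smoothness open of the sections (`exists_pencil_through_open`,
  `exists_lineMap`), whose good members ARE fibres of the family of sections
  (`pencil_smooth_and_members_iso`, `exists_iso_fiberOver_sectionFamily_proj`), then the fixed-class
  pencil step on `X_{⋆} ≅ X`.
* `mem_algebraicClasses_of_vhc_of_anchor_proj` — under VHC for projective smooth families, with an anchor
  fibre of `proj` on which the rational `(q+1,q+1)`-class `c` is algebraic: `c` is algebraic
  (`Theorems.sidewaysTransfer_proj` feeds the previous theorem).
* `mem_algebraicClasses_of_vhc_of_anchor` — the same with the anchor in the line's vocabulary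
  `e.hypersurfaceSection (linForm e.n a₀)` (`Motives.UniversalHyperplaneSection.exists_iso_fiberOver_proj_hypersurfaceSection_of_isSmoothProjective`).
* `mem_algebraicClasses_two_of_vhc_of_hyperplaneSection` — **VHC ⇒ weak Lefschetz for codimension-two
  algebraic classes across one smooth hyperplane section** of an `(n+1)`-fold, `n ≥ 4` (the Hodge type
  `(2,2)` is read off the section by weak Lefschetz injectivity; no anchor stub, no spreading stub) — the
  form in which the route feeds hyperplane sections to the crux.
* `weakLefschetzAlgebraicClasses_two_of_anchor` — **the crux `WeakLefschetzAlgebraicClasses` in its first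
  open case `p = 2` (`dim X = n + 1 ≥ 5`), from (V) and (A) alone**: the body of
  `Theses.AffinePartDecay.WeakLefschetzAlgebraicClasses` at `p = 2`, with the projective-family VHC and
  the anchor stub (A) as displayed hypotheses; (R) and (T) are the landed theorems, (S) is not used.
* `weakLefschetzAlgebraicClasses_of_anchor_of_hodgeBelow` — all `p ≥ 1`, modulo (V), (A) and the Hodge
  conjecture for rational `(p-1,p-1)`-classes on `X`.

No definition, no named fact, no `sorry`; `HC_CM` does not occur.

## References

* [DecataldoMigliorini2009] M. A. de Cataldo, L. Migliorini, On singularities of primitive cohomology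
  classes, Proc. AMS 137 (2009), §4 Prop. 4.5 and its proof (arXiv:0711.1307v1 pp. 10–11).
* [Thomas2005Nodes] R. P. Thomas, Nodes and the Hodge conjecture, J. Algebraic Geom. 14 (2005), §2 and §5.
* [VoisinHodgeII2003] C. Voisin, Hodge Theory and Complex Algebraic Geometry II (2003), §2.1.1, §3.2.2, §3.3.1.
* [VoisinHodgeI2002] C. Voisin, Hodge Theory and Complex Algebraic Geometry I (2002), Thm. 11.30;
  [CharlesSchnell2014Notes] F. Charles, C. Schnell, Notes on absolute Hodge classes (2014), Conj. 11.3.1.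
-/

noncomputable section

set_option linter.dupNamespace false
open CategoryTheory CategoryTheory.Limits AlgebraicGeometry TopologicalSpace MonoidalCategory
  CartesianMonoidalCategory
open Literature.AlgebraicGeometry.Motives Literature.AlgebraicGeometry.HodgeTheory
open Literature.AlgebraicGeometry.Motives.UniversalHyperplaneSection
open Literature.AlgebraicGeometry.Motives.SectionFamily Literature.AlgebraicGeometry.HodgeTheory.SectionFamily
open Literature.AlgebraicTopology.SingularHomology

namespace Summit.HodgeConjecture.HodgeConjecture.Theorems

/-! ### Down from the smooth hyperplane sections to `X` by a pencil -/

set_option maxHeartbeats 800000 in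
/-- **Fibrewise algebraic on the smooth hyperplane sections ⇒ algebraic, modulo the Hodge conjecture one
codimension down.** Let `X` be smooth projective of dimension `n + 1`, `ι : X ⟶ ℙᴺ` a closed immersion,
`2(q+1) ≤ n`, and assume every rational `(q,q)`-class of `X` is algebraic. If `c ∈ H^{2q+2}(X(ℂ); ℂ)`
restricts to an algebraic class on every fibre `X ∩ H` of `proj : 𝒴 ⟶ (ℙᴺ)^*` (the family of all
hyperplane sections of `X`) which is a smooth projective `n`-fold, then `c ∈ algebraicClasses X (q + 1)`.
Proof: over the generic-smoothness open `U ⊆ (ℙᴺ)^*` of the sections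
(`exists_open_forall_smooth_fiberOver_slice` for the constant family `X ⟶ Spec ℂ`) choose a good pencil
`(a₀, a₁)` of `X_⋆ ≅ X` with `[a₀] ∈ U` (`exists_pencil_through_open`) and its line `Λ`
(`exists_lineMap`); over `Λ⁻¹ U` its members are smooth projective `n`-folds isomorphic over `X` to fibres
of the family of sections (`pencil_smooth_and_members_iso`, `exists_iso_fiberOver_sectionFamily_proj`),
so `c` is algebraic on them; `ℙ¹ ∖ Λ⁻¹ U` is a proper closed subset (`[0 : 1] ∈ Λ⁻¹ U`); conclude by the
fixed-class pencil step `HodgeTheory.mem_algebraicClasses_of_pencil_members` on `X_⋆` and transport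
along `X_⋆ ≅ X`. [cite: VoisinHodgeII2003, §2.1.1 and §3.2.2]
[cite: DecataldoMigliorini2009, §4 Prop. 4.5 and its proof (arXiv v1 pp. 10–11)] -/
theorem mem_algebraicClasses_of_forall_fiberOver_proj
    {n q N : ℕ} {X : SchemeOver ℂ} (hX : IsSmoothProjective (n + 1) X)
    (ι : X ⟶ projectiveSpace N ℂ) [IsClosedImmersion ι.left] (hqn : 2 * (q + 1) ≤ n)
    (hIH : ∀ c' : complexBetti X (2 * q), IsRationalClass c' → IsOfHodgeType (n + 1) X (2 * q) q q c' →
      c' ∈ algebraicClasses X q)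
    (c : complexBetti X (2 * (q + 1)))
    (halg : ∀ t : ComplexPoints (dualProjectiveSpace N ℂ), IsSmoothProjective n (fiberOver (proj N ι) t) →
      complexBetti.map (fiberι (proj N ι) t ≫ toX N ι) (2 * (q + 1)) c ∈
        algebraicClasses (fiberOver (proj N ι) t) (q + 1)) :
    c ∈ algebraicClasses X (q + 1) := by
  -- the constant family `X ⟶ Spec ℂ`, its point `⋆`, the fibre `X_⋆ ≅ X`
  have hn : 1 ≤ n := by omega
  have hf : IsSmoothProjectiveFamily (toSpecOver X) (n + 1) := isSmoothProjectiveFamily_toSpecOver hX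
  haveI : IrreducibleSpace (specOver ℂ ℂ).left := irreducibleSpace_specOver_left
  haveI : IsAffine (specOver ℂ ℂ).left := inferInstanceAs (IsAffine (Spec (CommRingCat.of ℂ)))
  haveI : AlgebraicGeometry.Smooth (specOver ℂ ℂ).hom := smooth_specOver_hom
  haveI : LocallyOfFiniteType (specOver ℂ ℂ).hom := inferInstance
  haveI : IsSeparated (specOver ℂ ℂ).hom := inferInstance
  obtain ⟨d, hd⟩ := exists_smoothOfRelativeDimension_of_smooth (specOver ℂ ℂ).hom
  haveI := hd
  haveI : IsAffineHom ι.left := inferInstance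
  haveI hiso : IsIso (fiberι (toSpecOver X) (toSpecOver (specOver ℂ ℂ))) :=
    isIso_fiberι_toSpecOver (X := X) _
  haveI hι' : IsClosedImmersion (fiberι (toSpecOver X) (toSpecOver (specOver ℂ ℂ)) ≫ ι).left := by
    haveI : IsIso (fiberι (toSpecOver X) (toSpecOver (specOver ℂ ℂ))).left :=
      inferInstanceAs (IsIso ((Over.forget _).map (fiberι (toSpecOver X) (toSpecOver (specOver ℂ ℂ)))))
    rw [Over.comp_left]
    infer_instance
  have hN : 2 ≤ N := by
    have h := le_of_isClosedImmersion_projectiveSpace hX ι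
    omega
  have hX' : IsSmoothProjective (n + 1) (fiberOver (toSpecOver X) (toSpecOver (specOver ℂ ℂ))) :=
    hf.isSmoothProjective _
  -- the generic-smoothness open of the sections and a good pencil through it, with its line
  obtain ⟨U, hUne, hU⟩ :=
    exists_open_forall_smooth_fiberOver_slice (toSpecOver X) ι (toSpecOver (specOver ℂ ℂ)) hf (d := d) hN
  obtain ⟨a, ha₀, hminor, hXta, hconn, haU⟩ :=
    exists_pencil_through_open hX' (fiberι (toSpecOver X) (toSpecOver (specOver ℂ ℂ)) ≫ ι) hn (by omega) U hUne
  obtain ⟨Λ, hΛ⟩ := exists_lineMap a hminor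
  haveI := hconn
  obtain ⟨-, hmem⟩ :=
    pencil_smooth_and_members_iso (toSpecOver X) ι (toSpecOver (specOver ℂ ℂ)) Λ hf (d := d) hN a hXta hΛ U hU
  -- `[0 : 1] ∈ Λ⁻¹ U`, so `T := ℙ¹ ∖ Λ⁻¹ U` is a proper closed subset
  have h01 : (![0, 1] : Fin (1 + 1) → ℂ) ≠ 0 := fun h ↦ by
    have h1 := congrFun h 1
    simp only [Matrix.cons_val_one, Pi.zero_apply] at h1
    exact one_ne_zero h1
  obtain ⟨hc01, hΛ01⟩ := hΛ ![0, 1] h01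
  have hl0 : (ProjectiveSpace.pointOfVec ℂ ![0, 1] h01).pt ∈ Λ.left ⁻¹ᵁ U := by
    change Λ.left.base (ProjectiveSpace.pointOfVec ℂ ![0, 1] h01).pt ∈ U
    rw [← AlgPoints.pt_map, hΛ01]
    convert haU using 3
    funext i
    simp
  set T : Set (projectiveSpace 1 ℂ).left :=
    ((Λ.left ⁻¹ᵁ U : (projectiveSpace 1 ℂ).left.Opens) : Set (projectiveSpace 1 ℂ).left)ᶜ with hTdef
  have hT : IsClosed T := (Λ.left ⁻¹ᵁ U).isOpen.isClosed_compl
  have hTne : T ≠ Set.univ := fun h ↦ by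
    have hmemT : (ProjectiveSpace.pointOfVec ℂ ![0, 1] h01).pt ∈ T := h ▸ Set.mem_univ _
    exact hmemT hl0
  have hTiff : ∀ s : ComplexPoints (projectiveSpace 1 ℂ), s.pt ∉ T → s.pt ∈ Λ.left ⁻¹ᵁ U := fun s hs ↦ by
    by_contra h
    exact hs h
  -- the fibres of the family of sections over `(⋆, H)` are the fibres of `proj` over `H`
  have key : ∀ (b : ComplexPoints (specOver ℂ ℂ ⊗ dualProjectiveSpace N ℂ))
      (H : ComplexPoints (dualProjectiveSpace N ℂ)),
      b = CartesianMonoidalCategory.lift (toSpecOver (specOver ℂ ℂ)) H →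
      IsSmoothProjective n (fiberOver (CartesianMonoidalCategory.lift (toX N ι ≫ toSpecOver X) (proj N ι)) b) →
      complexBetti.map (fiberι (CartesianMonoidalCategory.lift (toX N ι ≫ toSpecOver X) (proj N ι)) b ≫ toX N ι)
          (2 * (q + 1)) c ∈
        algebraicClasses (fiberOver (CartesianMonoidalCategory.lift (toX N ι ≫ toSpecOver X) (proj N ι)) b)
          (q + 1) := by
    rintro b H rfl hb
    obtain ⟨φ, hφ⟩ := exists_iso_fiberOver_sectionFamily_proj ι H
    have hH : IsSmoothProjective n (fiberOver (proj N ι) H) := hb.of_iso φ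
    rw [← hφ, Category.assoc, complexBetti.map_comp, CategoryTheory.comp_apply]
    exact (mem_algebraicClasses_map_iff_of_iso φ).2 (halg H hH)
  -- the class on `X_⋆` and its restrictions to the good members of the pencil
  set c' : complexBetti (fiberOver (toSpecOver X) (toSpecOver (specOver ℂ ℂ))) (2 * (q + 1)) :=
    complexBetti.map (fiberι (toSpecOver X) (toSpecOver (specOver ℂ ℂ))) (2 * (q + 1)) c with hc'def
  have halg' : ∀ s : ComplexPoints (projectiveSpace 1 ℂ), s.pt ∉ T →
      complexBetti.map (fiberι (LinearSectionNet.proj (fiberι (toSpecOver X) (toSpecOver (specOver ℂ ℂ)) ≫ ι) a) s ≫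
          LinearSectionNet.blowDown (fiberι (toSpecOver X) (toSpecOver (specOver ℂ ℂ)) ≫ ι) a) (2 * (q + 1)) c' ∈
        algebraicClasses
          (fiberOver (LinearSectionNet.proj (fiberι (toSpecOver X) (toSpecOver (specOver ℂ ℂ)) ≫ ι) a) s)
          (q + 1) := by
    intro s hs
    obtain ⟨hZ, ψ, hψ⟩ := hmem s (hTiff s hs)
    have hb : AlgPoints.map (Λ ≫ CartesianMonoidalCategory.lift
        (toSpecOver (dualProjectiveSpace N ℂ) ≫ toSpecOver (specOver ℂ ℂ)) (𝟙 (dualProjectiveSpace N ℂ))) s =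
        CartesianMonoidalCategory.lift (toSpecOver (specOver ℂ ℂ)) (AlgPoints.map Λ s) := by
      rw [AlgPoints.map_comp_apply, map_slice]
    have h := key _ (AlgPoints.map Λ s) hb (hZ.of_iso ψ)
    rw [hc'def, ← CategoryTheory.comp_apply, ← complexBetti.map_comp, Category.assoc, ← hψ,
      complexBetti.map_comp, CategoryTheory.comp_apply]
    exact (mem_algebraicClasses_map_iff_of_iso ψ).2 h
  -- the fixed-class pencil step on `X_⋆`
  have ha : a ≠ 0 := fun h ↦ ha₀ (by rw [h]; rfl)
  have hfib : ∀ s : ComplexPoints (projectiveSpace 1 ℂ), s.pt ∉ T →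
      IsSmoothProjective n
        (fiberOver (LinearSectionNet.proj (fiberι (toSpecOver X) (toSpecOver (specOver ℂ ℂ)) ≫ ι) a) s) :=
    fun s hs ↦ (hmem s (hTiff s hs)).1
  have hIH' := (forall_hodgeClass_mem_algebraicClasses_iff_of_iso
    (asIso (fiberι (toSpecOver X) (toSpecOver (specOver ℂ ℂ)))) q (n := n + 1)).2 hIH
  have hc' : c' ∈ algebraicClasses (fiberOver (toSpecOver X) (toSpecOver (specOver ℂ ℂ))) (q + 1) :=
    mem_algebraicClasses_of_pencil_members hX' (fiberι (toSpecOver X) (toSpecOver (specOver ℂ ℂ)) ≫ ι) ha hXta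
      hT hTne hfib hqn hIH' c' halg'
  -- back to `X` along `X_⋆ ≅ X`
  exact (mem_algebraicClasses_map_iff_of_iso (asIso (fiberι (toSpecOver X) (toSpecOver (specOver ℂ ℂ))))).1 hc'

/-! ### With the variational Hodge conjecture and an anchor -/

/-- **VHC + anchor + the Hodge conjecture one codimension down ⇒ algebraic.** Under the variational
Hodge conjecture for projective smooth families (the printed form, Charles–Schnell Conj. 11.3.1 —
verbatim the hypothesis of the stubs (A), (T) of the line `sideways_vhc_sweep`), for `X ⊆ ℙᴺ` smooth
projective of dimension `n + 1`, `2(q+1) ≤ n`, rational `(q,q)`-classes of `X` algebraic, a RATIONAL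
class `c` of Hodge type `(q+1,q+1)` which is algebraic on ONE smooth `n`-dimensional fibre `X ∩ H_{t₀}` of
`proj : 𝒴 ⟶ (ℙᴺ)^*` is algebraic on `X`: sideways by VHC (`Theorems.sidewaysTransfer_proj`) to every
smooth fibre, then down by a pencil (`mem_algebraicClasses_of_forall_fiberOver_proj`).
[cite: CharlesSchnell2014Notes, Conj. 11.3.1] [cite: VoisinHodgeII2003, §3.2.2 and §3.3.1]
[cite: DecataldoMigliorini2009, §4 Prop. 4.5 and its proof (arXiv v1 pp. 10–11)] -/
theorem mem_algebraicClasses_of_vhc_of_anchor_proj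
    (hV : ∀ ⦃k : ℕ⦄ ⦃𝒳 S : SchemeOver ℂ⦄ (f : 𝒳 ⟶ S), IsSmoothProjectiveFamily f k →
      (∃ (N : ℕ) (ι : 𝒳 ⟶ projectiveSpace N ℂ ⊗ S), IsClosedImmersion ι.left ∧
        ι ≫ CartesianMonoidalCategory.snd (projectiveSpace N ℂ) S = f) →
      IrreducibleSpace S.left → AlgebraicGeometry.Smooth S.hom →
      ∀ (q : ℕ) (A : complexBetti 𝒳 (2 * q)),
      (∀ s : ComplexPoints S, IsRationalClass (complexBetti.map (fiberι f s) (2 * q) A) ∧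
        IsOfHodgeType k (fiberOver f s) (2 * q) q q (complexBetti.map (fiberι f s) (2 * q) A)) →
      (∃ s₀ : ComplexPoints S,
        complexBetti.map (fiberι f s₀) (2 * q) A ∈ algebraicClasses (fiberOver f s₀) q) →
      ∀ s : ComplexPoints S,
        complexBetti.map (fiberι f s) (2 * q) A ∈ algebraicClasses (fiberOver f s) q)
    {n q N : ℕ} {X : SchemeOver ℂ} (hX : IsSmoothProjective (n + 1) X)
    (ι : X ⟶ projectiveSpace N ℂ) [IsClosedImmersion ι.left] (hqn : 2 * (q + 1) ≤ n)
    (hIH : ∀ c' : complexBetti X (2 * q), IsRationalClass c' → IsOfHodgeType (n + 1) X (2 * q) q q c' →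
      c' ∈ algebraicClasses X q)
    (c : complexBetti X (2 * (q + 1))) (hc : IsRationalClass c)
    (hcH : IsOfHodgeType (n + 1) X (2 * (q + 1)) (q + 1) (q + 1) c)
    (t₀ : ComplexPoints (dualProjectiveSpace N ℂ)) (ht₀ : IsSmoothProjective n (fiberOver (proj N ι) t₀))
    (halg₀ : complexBetti.map (fiberι (proj N ι) t₀ ≫ toX N ι) (2 * (q + 1)) c ∈
      algebraicClasses (fiberOver (proj N ι) t₀) (q + 1)) :
    c ∈ algebraicClasses X (q + 1) :=
  mem_algebraicClasses_of_forall_fiberOver_proj hX ι hqn hIH c fun t ht ↦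
    sidewaysTransfer_proj hV hX (by omega) ι c hc hcH t₀ t ht₀ halg₀ ht

/-- **The same with the anchor in the line's vocabulary** (`e : ProjectiveEmbedding X`, the zero scheme
`X ∩ V₊(ℓ_{a₀}) = e.hypersurfaceSection (linForm e.n a₀)` — the output of the anchor stub (A) and the
input of the sideways stub (T) of `sideways_vhc_sweep`): the fibre of `proj` over `[a₀]` IS that zero
scheme when it is smooth (`Motives.UniversalHyperplaneSection.exists_iso_fiberOver_proj_hypersurfaceSection_of_isSmoothProjective`).
[cite: VoisinHodgeII2003, §2.3.1 and §3.2.2] [cite: CharlesSchnell2014Notes, Conj. 11.3.1] -/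
theorem mem_algebraicClasses_of_vhc_of_anchor
    (hV : ∀ ⦃k : ℕ⦄ ⦃𝒳 S : SchemeOver ℂ⦄ (f : 𝒳 ⟶ S), IsSmoothProjectiveFamily f k →
      (∃ (N : ℕ) (ι : 𝒳 ⟶ projectiveSpace N ℂ ⊗ S), IsClosedImmersion ι.left ∧
        ι ≫ CartesianMonoidalCategory.snd (projectiveSpace N ℂ) S = f) →
      IrreducibleSpace S.left → AlgebraicGeometry.Smooth S.hom →
      ∀ (q : ℕ) (A : complexBetti 𝒳 (2 * q)),
      (∀ s : ComplexPoints S, IsRationalClass (complexBetti.map (fiberι f s) (2 * q) A) ∧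
        IsOfHodgeType k (fiberOver f s) (2 * q) q q (complexBetti.map (fiberι f s) (2 * q) A)) →
      (∃ s₀ : ComplexPoints S,
        complexBetti.map (fiberι f s₀) (2 * q) A ∈ algebraicClasses (fiberOver f s₀) q) →
      ∀ s : ComplexPoints S,
        complexBetti.map (fiberι f s) (2 * q) A ∈ algebraicClasses (fiberOver f s) q)
    {n q : ℕ} {X : SchemeOver ℂ} (hX : IsSmoothProjective (n + 1) X) (e : ProjectiveEmbedding X)
    (hqn : 2 * (q + 1) ≤ n)
    (hIH : ∀ c' : complexBetti X (2 * q), IsRationalClass c' → IsOfHodgeType (n + 1) X (2 * q) q q c' →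
      c' ∈ algebraicClasses X q)
    (c : complexBetti X (2 * (q + 1))) (hc : IsRationalClass c)
    (hcH : IsOfHodgeType (n + 1) X (2 * (q + 1)) (q + 1) (q + 1) c)
    {a₀ : Fin (e.n + 1) → ℂ} (ha₀ : a₀ ≠ 0)
    (hsm₀ : IsSmoothProjective n (e.hypersurfaceSection (linForm e.n a₀) (isHomogeneous_linForm e.n a₀)))
    (halg₀ : complexBetti.map (e.hypersurfaceSectionι (linForm e.n a₀) (isHomogeneous_linForm e.n a₀))
      (2 * (q + 1)) c ∈
      algebraicClasses (e.hypersurfaceSection (linForm e.n a₀) (isHomogeneous_linForm e.n a₀)) (q + 1)) :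
    c ∈ algebraicClasses X (q + 1) := by
  haveI : IsClosedImmersion e.ι.left := e.isClosedImmersion
  have ht₀ := isSmoothProjective_fiberOver_proj_of_hypersurfaceSection e a₀ ha₀ hsm₀
  obtain ⟨φ₀, hφ₀⟩ := exists_iso_fiberOver_proj_hypersurfaceSection_of_isSmoothProjective e a₀ ha₀ hsm₀
  have halg₀' : complexBetti.map (fiberι (proj e.n e.ι) (ProjectiveSpace.pointOfVec ℂ a₀ ha₀) ≫ toX e.n e.ι)
      (2 * (q + 1)) c ∈
      algebraicClasses (fiberOver (proj e.n e.ι) (ProjectiveSpace.pointOfVec ℂ a₀ ha₀)) (q + 1) := by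
    rw [← hφ₀, complexBetti.map_comp, CategoryTheory.comp_apply]
    exact (mem_algebraicClasses_map_iff_of_iso φ₀).2 halg₀
  exact mem_algebraicClasses_of_vhc_of_anchor_proj hV hX e.ι hqn hIH c hc hcH _ ht₀ halg₀'

/-- **VHC ⇒ weak Lefschetz for codimension-two algebraic classes across ONE smooth hyperplane section**
(the form in which the route `AffinePartDecay` feeds hyperplane sections to the crux; no anchor stub, no
spreading stub): under the variational Hodge conjecture for projective smooth families, for `X` smooth
projective of dimension `n + 1 ≥ 5` with a projective embedding `e` and a SMOOTH hyperplane section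
`X ∩ V₊(ℓ_{a₀})`, a rational class `c ∈ H⁴(X(ℂ); ℂ)` whose restriction to `X ∩ V₊(ℓ_{a₀})` is algebraic is
algebraic on `X`. The Hodge type `(2,2)` of `c` is read off the section (algebraic classes are Hodge
classes, `H⁴(X) → H⁴(X ∩ V₊(ℓ_{a₀}))` is injective by weak Lefschetz and injective pull-backs detect Hodge
types, `IsOfHodgeType.of_map_of_injective`); then `mem_algebraicClasses_of_vhc_of_anchor` at `q + 1 = 2`
with Lefschetz `(1,1)` (`lefschetzOneOne_rational_holds`) in codimension one.
[cite: VoisinHodgeII2003, §1.2.2 Thm. 1.23 and §3.2.2] [cite: VoisinHodgeI2002, Thm. 11.30 and §7.3.2]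
[cite: CharlesSchnell2014Notes, Conj. 11.3.1] [cite: DecataldoMigliorini2009, §4 Prop. 4.5 and its proof (arXiv v1 pp. 10–11)] -/
theorem mem_algebraicClasses_two_of_vhc_of_hyperplaneSection
    (hV : ∀ ⦃k : ℕ⦄ ⦃𝒳 S : SchemeOver ℂ⦄ (f : 𝒳 ⟶ S), IsSmoothProjectiveFamily f k →
      (∃ (N : ℕ) (ι : 𝒳 ⟶ projectiveSpace N ℂ ⊗ S), IsClosedImmersion ι.left ∧
        ι ≫ CartesianMonoidalCategory.snd (projectiveSpace N ℂ) S = f) →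
      IrreducibleSpace S.left → AlgebraicGeometry.Smooth S.hom →
      ∀ (q : ℕ) (A : complexBetti 𝒳 (2 * q)),
      (∀ s : ComplexPoints S, IsRationalClass (complexBetti.map (fiberι f s) (2 * q) A) ∧
        IsOfHodgeType k (fiberOver f s) (2 * q) q q (complexBetti.map (fiberι f s) (2 * q) A)) →
      (∃ s₀ : ComplexPoints S,
        complexBetti.map (fiberι f s₀) (2 * q) A ∈ algebraicClasses (fiberOver f s₀) q) →
      ∀ s : ComplexPoints S,
        complexBetti.map (fiberι f s) (2 * q) A ∈ algebraicClasses (fiberOver f s) q)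
    {n : ℕ} {X : SchemeOver ℂ} (hX : IsSmoothProjective (n + 1) X) (e : ProjectiveEmbedding X) (hn : 4 ≤ n)
    (c : complexBetti X (2 * 2)) (hc : IsRationalClass c)
    {a₀ : Fin (e.n + 1) → ℂ} (ha₀ : a₀ ≠ 0)
    (hsm₀ : IsSmoothProjective n (e.hypersurfaceSection (linForm e.n a₀) (isHomogeneous_linForm e.n a₀)))
    (halg₀ : complexBetti.map (e.hypersurfaceSectionι (linForm e.n a₀) (isHomogeneous_linForm e.n a₀))
      (2 * 2) c ∈
      algebraicClasses (e.hypersurfaceSection (linForm e.n a₀) (isHomogeneous_linForm e.n a₀)) 2) :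
    c ∈ algebraicClasses X 2 := by
  have hcH : IsOfHodgeType (n + 1) X (2 * 2) 2 2 c :=
    IsOfHodgeType.of_map_of_injective hsm₀ hX _ rfl
      (injective_complexBettiMap_hypersurfaceSection hX e le_rfl (linForm e.n a₀) (isHomogeneous_linForm e.n a₀)
        hsm₀ (by omega))
      (isOfHodgeType_of_mem_algebraicClasses_of_isSmoothProjective hsm₀ 2 halg₀)
  exact mem_algebraicClasses_of_vhc_of_anchor hV hX e (q := 1) hn
    (fun c' hc' hc'H ↦ lefschetzOneOne_rational_holds hX c' hc' hc'H) c hc hcH ha₀ hsm₀ halg₀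

/-! ### The crux at `p = 2` from (V) and (A); all `p` modulo the Hodge conjecture one codimension down -/

/-- **The crux `WeakLefschetzAlgebraicClasses` for all `p ≥ 1`, from (V), (A) and the Hodge conjecture
for rational `(p-1,p-1)`-classes on `X`** (the body of `Theses.AffinePartDecay.WeakLefschetzAlgebraicClasses`
with these three displayed hypotheses; (R) = `Theorems.stub_hodgeTypeReflected` and (T) =
`Theorems.sidewaysTransfer_proj` are theorems of the tree, and the spreading stub (S) of the line is NOT
used): for `i : H ⟶ X` a closed immersion of smooth projective varieties, `dim X = n + 1`, `dim H = n`,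
`X ∖ i(H)` affine, `2(q+1) ≤ n`, a rational `c ∈ H^{2q+2}(X(ℂ); ℂ)` with `i^* c` algebraic is algebraic.
[cite: VoisinHodgeII2003, §3.2.2, §3.3.1 and Thm. 1.23] [cite: CharlesSchnell2014Notes, Conj. 11.3.1]
[cite: DecataldoMigliorini2009, §4 Prop. 4.5 and its proof (arXiv v1 pp. 10–11)] -/
theorem weakLefschetzAlgebraicClasses_of_anchor_of_hodgeBelow
    (hV : ∀ ⦃k : ℕ⦄ ⦃𝒳 S : SchemeOver ℂ⦄ (f : 𝒳 ⟶ S), IsSmoothProjectiveFamily f k →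
      (∃ (N : ℕ) (ι : 𝒳 ⟶ projectiveSpace N ℂ ⊗ S), IsClosedImmersion ι.left ∧
        ι ≫ CartesianMonoidalCategory.snd (projectiveSpace N ℂ) S = f) →
      IrreducibleSpace S.left → AlgebraicGeometry.Smooth S.hom →
      ∀ (q : ℕ) (A : complexBetti 𝒳 (2 * q)),
      (∀ s : ComplexPoints S, IsRationalClass (complexBetti.map (fiberι f s) (2 * q) A) ∧
        IsOfHodgeType k (fiberOver f s) (2 * q) q q (complexBetti.map (fiberι f s) (2 * q) A)) →
      (∃ s₀ : ComplexPoints S,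
        complexBetti.map (fiberι f s₀) (2 * q) A ∈ algebraicClasses (fiberOver f s₀) q) →
      ∀ s : ComplexPoints S,
        complexBetti.map (fiberι f s) (2 * q) A ∈ algebraicClasses (fiberOver f s) q)
    (hA : ∀ ⦃n p : ℕ⦄ ⦃X H : SchemeOver ℂ⦄ (i : H ⟶ X), IsSmoothProjective (n + 1) X → IsSmoothProjective n H →
      IsClosedImmersion i.left →
      (∀ U : X.left.Opens, (U : Set X.left) = (Set.range i.left.base)ᶜ → IsAffineOpen U) →
      2 * p ≤ n → 1 ≤ p → ∀ (c : complexBetti X (2 * p)), IsRationalClass c →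
        IsOfHodgeType (n + 1) X (2 * p) p p c →
        complexBetti.map i (2 * p) c ∈ algebraicClasses H p →
        ∃ (e : ProjectiveEmbedding X) (a₀ : Fin (e.n + 1) → ℂ) (_ : a₀ ≠ 0),
          IsSmoothProjective n (e.hypersurfaceSection (linForm e.n a₀) (isHomogeneous_linForm e.n a₀)) ∧
          complexBetti.map (e.hypersurfaceSectionι (linForm e.n a₀) (isHomogeneous_linForm e.n a₀)) (2 * p) c ∈
            algebraicClasses (e.hypersurfaceSection (linForm e.n a₀) (isHomogeneous_linForm e.n a₀)) p)
    ⦃n q : ℕ⦄ ⦃X H : SchemeOver ℂ⦄ (i : H ⟶ X) (hX : IsSmoothProjective (n + 1) X)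
    (hH : IsSmoothProjective n H) (hi : IsClosedImmersion i.left)
    (hU : ∀ U : X.left.Opens, (U : Set X.left) = (Set.range i.left.base)ᶜ → IsAffineOpen U)
    (hqn : 2 * (q + 1) ≤ n)
    (hIH : ∀ c' : complexBetti X (2 * q), IsRationalClass c' → IsOfHodgeType (n + 1) X (2 * q) q q c' →
      c' ∈ algebraicClasses X q)
    (c : complexBetti X (2 * (q + 1))) (hc : IsRationalClass c)
    (halg : complexBetti.map i (2 * (q + 1)) c ∈ algebraicClasses H (q + 1)) :
    c ∈ algebraicClasses X (q + 1) := by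
  -- reflection (R), landed: `c` is of Hodge type `(q+1, q+1)`
  have hcH : IsOfHodgeType (n + 1) X (2 * (q + 1)) (q + 1) (q + 1) c :=
    stub_hodgeTypeReflected i hX hH hi hU hqn c halg
  -- anchor (A)
  obtain ⟨e, a₀, ha₀, hsm₀, halg₀⟩ := hA i hX hH hi hU hqn (by omega) c hc hcH halg
  exact mem_algebraicClasses_of_vhc_of_anchor hV hX e hqn hIH c hc hcH ha₀ hsm₀ halg₀

/-- **The first open case `p = 2` of the crux `WeakLefschetzAlgebraicClasses`, from (V) and (A) alone**:
under the variational Hodge conjecture for projective smooth families and the anchor stub (A) of the line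
`sideways_vhc_sweep`, for `i : H ⟶ X` a closed immersion of smooth projective complex varieties,
`dim X = n + 1 ≥ 5`, `dim H = n`, `X ∖ i(H)` affine, a rational class `c ∈ H⁴(X(ℂ); ℂ)` whose restriction
`i^* c` is algebraic on `H` is algebraic on `X` — `weakLefschetzAlgebraicClasses_of_anchor_of_hodgeBelow` at
`q + 1 = 2`, the Hodge conjecture in codimension one being the Lefschetz theorem on `(1,1)`-classes
(`lefschetzOneOne_rational_holds`). No spreading over the complete linear system is used.
[cite: VoisinHodgeI2002, Thm. 11.30] [cite: VoisinHodgeII2003, §3.2.2 and §3.3.1]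
[cite: DecataldoMigliorini2009, §4 Prop. 4.5 and its proof (arXiv v1 pp. 10–11)] -/
theorem weakLefschetzAlgebraicClasses_two_of_anchor
    (hV : ∀ ⦃k : ℕ⦄ ⦃𝒳 S : SchemeOver ℂ⦄ (f : 𝒳 ⟶ S), IsSmoothProjectiveFamily f k →
      (∃ (N : ℕ) (ι : 𝒳 ⟶ projectiveSpace N ℂ ⊗ S), IsClosedImmersion ι.left ∧
        ι ≫ CartesianMonoidalCategory.snd (projectiveSpace N ℂ) S = f) →
      IrreducibleSpace S.left → AlgebraicGeometry.Smooth S.hom →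
      ∀ (q : ℕ) (A : complexBetti 𝒳 (2 * q)),
      (∀ s : ComplexPoints S, IsRationalClass (complexBetti.map (fiberι f s) (2 * q) A) ∧
        IsOfHodgeType k (fiberOver f s) (2 * q) q q (complexBetti.map (fiberι f s) (2 * q) A)) →
      (∃ s₀ : ComplexPoints S,
        complexBetti.map (fiberι f s₀) (2 * q) A ∈ algebraicClasses (fiberOver f s₀) q) →
      ∀ s : ComplexPoints S,
        complexBetti.map (fiberι f s) (2 * q) A ∈ algebraicClasses (fiberOver f s) q)
    (hA : ∀ ⦃n p : ℕ⦄ ⦃X H : SchemeOver ℂ⦄ (i : H ⟶ X), IsSmoothProjective (n + 1) X → IsSmoothProjective n H →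
      IsClosedImmersion i.left →
      (∀ U : X.left.Opens, (U : Set X.left) = (Set.range i.left.base)ᶜ → IsAffineOpen U) →
      2 * p ≤ n → 1 ≤ p → ∀ (c : complexBetti X (2 * p)), IsRationalClass c →
        IsOfHodgeType (n + 1) X (2 * p) p p c →
        complexBetti.map i (2 * p) c ∈ algebraicClasses H p →
        ∃ (e : ProjectiveEmbedding X) (a₀ : Fin (e.n + 1) → ℂ) (_ : a₀ ≠ 0),
          IsSmoothProjective n (e.hypersurfaceSection (linForm e.n a₀) (isHomogeneous_linForm e.n a₀)) ∧
          complexBetti.map (e.hypersurfaceSectionι (linForm e.n a₀) (isHomogeneous_linForm e.n a₀)) (2 * p) c ∈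
            algebraicClasses (e.hypersurfaceSection (linForm e.n a₀) (isHomogeneous_linForm e.n a₀)) p)
    ⦃n : ℕ⦄ ⦃X H : SchemeOver ℂ⦄ (i : H ⟶ X) (hX : IsSmoothProjective (n + 1) X)
    (hH : IsSmoothProjective n H) (hi : IsClosedImmersion i.left)
    (hU : ∀ U : X.left.Opens, (U : Set X.left) = (Set.range i.left.base)ᶜ → IsAffineOpen U)
    (hn : 2 * 2 ≤ n) (c : complexBetti X (2 * 2)) (hc : IsRationalClass c)
    (halg : complexBetti.map i (2 * 2) c ∈ algebraicClasses H 2) :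
    c ∈ algebraicClasses X 2 :=
  weakLefschetzAlgebraicClasses_of_anchor_of_hodgeBelow hV hA i hX hH hi hU (q := 1) hn
    (fun c' hc' hc'H ↦ lefschetzOneOne_rational_holds hX c' hc' hc'H) c hc halg

end Summit.HodgeConjecture.HodgeConjecture.Theorems

end
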